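import Literature.Computability.AlgebraicComplexity.KronRectDesignCertificates
import Literature.Computability.AlgebraicComplexity.BILPS19LatinRectangleConditionEventually
import Literature.Computability.AlgebraicComplexity.BI17MinimalDegreeNearSquares
import HarnessLib

/-!
# Rectangular Kronecker positivity from the Latin-rectangle condition:
# `LRC(n, δ) ⇒ k_n(δ) > 0` (BILPS 2019 Thm 27's isotypic type; Amanov–Yeliussizov 2022 Cor. 8.7 for `d = 3`)

THEOREM-ONLY bridge between two vocabularies already in the tree:

* the **Latin-rectangle condition** `LRC(α, β)` of Bläser–Ikenmeyer–Lysikov–Pandey–Schreyer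
  (arXiv:1911.02534 §7.3, statement 26; tree `latinRectangleCondition α β`, with Kumar's patterns and
  signed counts `Kumar2015.signedCount`, `♯L⁺_𝒜 − ♯L⁻_𝒜`, Compositio Math. 151 (2015) Def. 4.1), for
  which the tree PROVES `LRC(α, β) ⇔ ∃ 𝒜, ♯L⁺_𝒜 ≠ ♯L⁻_𝒜`
  (`BILPS2019.latinRectangleCondition_iff_exists_signedCount_ne_zero`) and the unconditional cases
  `α ≤ 12 ≤` every even `β ≥ α`, `α ≤ β` even `≤ 24`, `β = p ± 1`, every even `β ≥ 2α²`
  (`BILPS19LatinRectangleCondition{AlonTarsi,Additivity,Eventually}.lean`);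
* the **rectangular Kronecker coefficients** `k_m(δ) = g(m × δ, m × δ, m × δ)` of Bürgisser–Ikenmeyer
  2017 §5 (`kronRect`), the degree monoids `E(m)` of generic tensors, and the block-sign DESIGN
  CERTIFICATES `kronRect_pos_of_sum_blockSignTriple_diag_ne_zero` (`KronRectDesignCertificates.lean` §1:
  a nonzero diagonal trace `∑_u ζ_{e₁}(u) ζ_{e₂}(u) ζ_{e₃}(u)` of three block structures certifies
  `k_m(δ) > 0`).

**The bridge (`kronRect_pos_of_latinRectangleCondition`): `LRC(n, δ) ⇒ 0 < k_n(δ)`.** This is the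
Kronecker-coefficient content of the ISOTYPIC TYPE in BILPS Thm 27 ("there exists an irreducible
representation of nontrivial equations for `𝓜_r` in degree `km` of type `((k × m), (m × k), (m × k))`",
p0026:L36 — the typed fact `BILPS2019_thm27` keeps only "a nonzero homogeneous equation of degree
`km`" and drops the type): a highest weight vector of type `((m^k), (k^m), (k^m))` exhibits
`g((m^k), (k^m), (k^m)) = g((m^k), (m^k), (m^k)) = k_k(m) ≥ 1` (transposition property). For `d = 3`
it is also Amanov–Yeliussizov's Cor. 8.7 / Rem. 8.8 ("Assume `AT(k) ≠ 0` for even `k`. Then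
`g_d(n,k) > 0` for all `n ≤ k`"; "hence … `δ_d(k^{d-1} - n) = (k^{d-1} - n) k` for all `n ≤ k`") in the
stronger pattern form of their Rem. 8.9 ("for `d = 3` analogous statements … can also be obtained from
results in [Kumar 2015]").

**Route (ours, in the tree's word model; no new vocabulary).** For a pattern `𝒜 = (𝒜^q)_{q < δ}`
(`𝒜^q ⊆ [δ]` the set of symbols of column `q`, `|𝒜^q| = n`) take the INCIDENCE DESIGN on the `nδ`
positions `(q, s)`, `s ∈ 𝒜^q`: the column blocks `{(q, s) : s ∈ 𝒜^q}` ordered by the symbol, and the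
symbol blocks `{(q, s) : q ∋ s}`. A word `u` (letters = the `n` ROWS) is a proper colouring of the
column structure `e_C` and of the symbol structure `e_S` exactly when "symbol `s` sits in row `u(q,s)`
of column `q`" is a Latin `(n, δ)`-rectangle with pattern `𝒜`; the column block signs multiply to
Kumar's column sign `ε_c` (a column read by increasing symbol is the inverse permutation of the column
read by increasing row), and the symbol block signs enter SQUARED. Hence the diagonal trace of
`(e_C, e_S, e_S)` is `♯L⁺_𝒜 − ♯L⁻_𝒜` (`LRCDesign.sum_blockSignTriple_incidence_eq_signedCount`), and a pattern
with `♯L⁺_𝒜 ≠ ♯L⁻_𝒜` certifies `k_n(δ) > 0`.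

**Unconditional corollaries** (by name, from the tree's `LRC` theorems): `0 < k_n(δ)` for every
`n ≤ 12` and every even `δ ≥ n`; for every `n ≤ δ` with `δ` even `≤ 24` or `δ = p ± 1` (`p` an odd
prime); for EVERY `n` and every even `δ ≥ 2n²` (`kronRect_pos_of_two_mul_sq_le`: "`E'(n)` contains
every even `δ ≥ 2n²`"); and, through the complement symmetry `k_j(δ) = k_{δ²-j}(δ)`
(`BI17MinimalDegreeNearSquares`), the minimal degrees **`e(δ² − j) = (δ² − j)·δ` for all `j ≤ δ`**
whenever `AT(δ)` holds — unconditionally for `δ` even `≤ 24` and `δ = p ± 1` (AY Rem. 8.8; the tree had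
`j ≤ 6`).

Honest scope (cell `val-lit`): `LRC(n, δ)` forces `n ≤ δ` and `δ` even, so none of the odd-`δ` atoms of
`BI2017_ex_5_6` (`k_9(5)`, `k_10(7)`, `k_11(5)`, `k_11(7)`, `k_12(5)`, `k_12(7)`) is touched; VP ≠ VNP
is NOT proved and rectangular Kronecker positivity is invariant-theory bookkeeping, not progress on it.
No definitions beyond `private` plumbing, no named facts.

## References

* [BlaserIkenmeyerLysikovPandeySchreyer2019] M. Bläser, C. Ikenmeyer, V. Lysikov, A. Pandey,
  F.-O. Schreyer, arXiv:1911.02534, §7.3: statement 26 (`LRC(α, β)`), Thm. 27 (type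
  `((k×m),(m×k),(m×k))`, p0026:L36), "Construction of highest weight vectors" (p0026:L41–50).
* [Kumar2015] S. Kumar, Compositio Math. 151 (2015) 292–312, Def. 4.1 (patterns, `ε_c`, signed
  counts), Lemma 4.2.
* [AmanovYeliussizov2022] A. Amanov, D. Yeliussizov, IMRN 2023 = arXiv:2202.11059 (held text
  `paper:arxiv-2202.11059`), §7.1 Prop. 7.1 (p0013:L15, the Latin-square table), §8: Lemma 8.2
  (p0017:L38), Thm. 8.4 (p0018:L37), Cor. 8.5–8.7 (p0019:L83–110), Rem. 8.8 (p0019:L112), Rem. 8.9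
  (p0020:L1: "For `d = 3` analogous statements on positivity of Kronecker coefficients as in the last
  corollary can also be obtained from results in [Kumar], see [Bürgisser, SLC 75 (2016)]").
* [BurgisserIkenmeyer2017] P. Bürgisser, C. Ikenmeyer, J. Algebra 477 (2017), §5: `k_m(δ)`, `E(m)`,
  Thm. 5.9 (proof of (2): the Latin-square design), Ex. 5.6, Problem 5.19.
-/

noncomputable section

open Literature.NumberTheory.DiophantineGeometry

namespace Literature.Computability.AlgebraicComplexity

open Kumar2015 BILPS2019 Literature.Barriers.ValiantsHypothesis

/-! ### §1 The incidence design of a pattern and its diagonal trace -/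

namespace LRCDesign

section IncidenceDesign

variable (K : Type*) [Field K] {n δ : ℕ}

/-- The `j`-th symbol (in increasing order) of the column set `𝒜^q` (plumbing). [folklore] -/
private def symbAt (A : Fin δ → Finset (Fin δ)) (hA : ∀ q, (A q).card = n) (q : Fin δ) (j : Fin n) :
    Fin δ :=
  (A q).orderEmbOfFin (hA q) j

/-- `symbAt q j ∈ 𝒜^q` (plumbing). [folklore] -/
private theorem symbAt_mem (A : Fin δ → Finset (Fin δ)) (hA : ∀ q, (A q).card = n) (q : Fin δ)
    (j : Fin n) : symbAt A hA q j ∈ A q :=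
  Finset.orderEmbOfFin_mem _ _ _

/-- `symbAt q` is strictly increasing (plumbing). [folklore] -/
private theorem symbAt_strictMono (A : Fin δ → Finset (Fin δ)) (hA : ∀ q, (A q).card = n) (q : Fin δ) :
    StrictMono (symbAt A hA q) :=
  ((A q).orderEmbOfFin (hA q)).strictMono

/-- `symbAt q` is injective (plumbing). [folklore] -/
private theorem symbAt_injective (A : Fin δ → Finset (Fin δ)) (hA : ∀ q, (A q).card = n) (q : Fin δ) :
    Function.Injective (symbAt A hA q) :=
  (symbAt_strictMono A hA q).injective

/-- Every symbol of `𝒜^q` is some `symbAt q j` (plumbing). [folklore] -/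
private theorem exists_symbAt_eq (A : Fin δ → Finset (Fin δ)) (hA : ∀ q, (A q).card = n) {q s : Fin δ}
    (hs : s ∈ A q) : ∃ j, symbAt A hA q j = s := by
  have h : s ∈ Set.range ((A q).orderEmbOfFin (hA q)) := by
    rw [Finset.range_orderEmbOfFin]; exact hs
  obtain ⟨j, hj⟩ := h
  exact ⟨j, hj⟩

/-- The word of `u` on block `a` of a block structure `e` (plumbing). [folklore] -/
private def blockWord (e : Fin (n * δ) ≃ Fin δ × Fin n) (u : Word n (n * δ)) (a : Fin δ) :
    Fin n → Fin n :=
  fun j => u (e.symm (a, j))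

/-- A position is read inside its own block (plumbing). [folklore] -/
private theorem blockWord_self (e : Fin (n * δ) ≃ Fin δ × Fin n) (u : Word n (n * δ))
    (x : Fin (n * δ)) : blockWord e u (e x).1 (e x).2 = u x := by
  simp [blockWord]

/-- Two positions of one block carrying the same letter of a proper colouring coincide (plumbing).
[folklore] -/
private theorem pos_eq_of_block_eq_of_letter_eq (e : Fin (n * δ) ≃ Fin δ × Fin n) (u : Word n (n * δ))
    (hu : ∀ a, Function.Bijective (blockWord e u a)) {x y : Fin (n * δ)} (hb : (e x).1 = (e y).1)
    (hl : u x = u y) : x = y := by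
  have h2 : (e x).2 = (e y).2 := by
    apply (hu (e x).1).1
    rw [blockWord_self, hl, ← blockWord_self e u y, hb]
  exact e.injective (Prod.ext hb h2)

/-- **From a proper colouring to a Latin rectangle**: row `p` of column `q` carries the symbol sitting
at the position of the column block whose letter is `p`. [cite: Kumar2015, Def. 4.1] -/
private def toRect (A : Fin δ → Finset (Fin δ)) (hA : ∀ q, (A q).card = n)
    (eC : Fin (n * δ) ≃ Fin δ × Fin n) (u : Word n (n * δ))
    (hu : ∀ q, Function.Bijective (blockWord eC u q)) : Fin n → Fin δ → Fin δ :=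
  fun p q => symbAt A hA q ((Equiv.ofBijective _ (hu q)).symm p)

/-- The letter at the position of column `q` carrying the symbol `R_u p q` is `p` (plumbing).
[cite: Kumar2015, Def. 4.1] -/
private theorem blockWord_toRect_index (eC : Fin (n * δ) ≃ Fin δ × Fin n) (u : Word n (n * δ))
    (hu : ∀ q, Function.Bijective (blockWord eC u q)) (p : Fin n) (q : Fin δ) :
    u (eC.symm (q, (Equiv.ofBijective _ (hu q)).symm p)) = p := by
  have h := Equiv.apply_symm_apply (Equiv.ofBijective _ (hu q)) p
  rwa [Equiv.ofBijective_apply] at h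

/-- Entries of an array with pattern `𝒜` lie in the column sets (plumbing). [cite: Kumar2015, Def. 4.1] -/
private theorem mem_of_pattern_eq {A : Fin δ → Finset (Fin δ)} {R : Fin n → Fin δ → Fin δ}
    (hP : pattern R = A) (p : Fin n) (q : Fin δ) : R p q ∈ A q := by
  rw [← hP]
  unfold pattern
  exact Finset.mem_image_of_mem _ (Finset.mem_univ p)

/-- **Column `q` of a Latin rectangle with pattern `𝒜` as a bijection `[n] ≃ 𝒜^q`** (rows ↦ symbols;
injective columns, `|𝒜^q| = n`). [cite: Kumar2015, Def. 4.1] -/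
private theorem colMap_bijective {A : Fin δ → Finset (Fin δ)} (hA : ∀ q, (A q).card = n)
    {R : Fin n → Fin δ → Fin δ} (hL : IsLatinRect R) (hP : pattern R = A) (q : Fin δ) :
    Function.Bijective (fun p => (⟨R p q, mem_of_pattern_eq hP p q⟩ : A q)) := by
  rw [Fintype.bijective_iff_injective_and_card]
  refine ⟨fun p p' h => hL.2 q (congrArg Subtype.val h), ?_⟩
  rw [Fintype.card_fin, Fintype.card_coe]
  exact (hA q).symm

/-- The column equivalence `[n] ≃ 𝒜^q` of a Latin rectangle with pattern `𝒜` (plumbing).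
[cite: Kumar2015, Def. 4.1] -/
private def colEquiv {A : Fin δ → Finset (Fin δ)} (hA : ∀ q, (A q).card = n)
    {R : Fin n → Fin δ → Fin δ} (hL : IsLatinRect R) (hP : pattern R = A) (q : Fin δ) : Fin n ≃ A q :=
  Equiv.ofBijective _ (colMap_bijective hA hL hP q)

/-- `colEquiv` unfolds to the column entries (plumbing). [folklore] -/
private theorem colEquiv_apply_val {A : Fin δ → Finset (Fin δ)} (hA : ∀ q, (A q).card = n)
    {R : Fin n → Fin δ → Fin δ} (hL : IsLatinRect R) (hP : pattern R = A) (q : Fin δ) (p : Fin n) :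
    ((colEquiv hA hL hP q p : A q) : Fin δ) = R p q := rfl

/-- The symbol of a position lies in the column set of its column (plumbing). [folklore] -/
private theorem symb_mem (A : Fin δ → Finset (Fin δ)) (hA : ∀ q, (A q).card = n)
    (eC eS : Fin (n * δ) ≃ Fin δ × Fin n) (hCS : ∀ x, symbAt A hA (eC x).1 (eC x).2 = (eS x).1)
    (x : Fin (n * δ)) : (eS x).1 ∈ A (eC x).1 := by
  rw [← hCS x]; exact symbAt_mem A hA _ _

/-- Two positions with the same column and the same symbol coincide (plumbing). [folklore] -/
private theorem pos_eq_of_col_eq_of_symb_eq (A : Fin δ → Finset (Fin δ)) (hA : ∀ q, (A q).card = n)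
    (eC eS : Fin (n * δ) ≃ Fin δ × Fin n) (hCS : ∀ x, symbAt A hA (eC x).1 (eC x).2 = (eS x).1)
    {x y : Fin (n * δ)} (hc : (eC x).1 = (eC y).1) (hs : (eS x).1 = (eS y).1) : x = y := by
  have h1 : symbAt A hA (eC x).1 (eC x).2 = symbAt A hA (eC x).1 (eC y).2 := by
    rw [hCS x, hs, ← hCS y, hc]
  exact eC.injective (Prod.ext hc (symbAt_injective A hA _ h1))

/-- **From a Latin rectangle with pattern `𝒜` to a proper colouring**: position `(q, s)` gets the row
in which the symbol `s` sits in column `q`. [cite: Kumar2015, Def. 4.1] -/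
private def toWord (A : Fin δ → Finset (Fin δ)) (hA : ∀ q, (A q).card = n)
    (eC eS : Fin (n * δ) ≃ Fin δ × Fin n) (hCS : ∀ x, symbAt A hA (eC x).1 (eC x).2 = (eS x).1)
    {R : Fin n → Fin δ → Fin δ} (hL : IsLatinRect R) (hP : pattern R = A) : Word n (n * δ) :=
  fun x => (colEquiv hA hL hP (eC x).1).symm ⟨(eS x).1, symb_mem A hA eC eS hCS x⟩

/-- The defining equation of `u_R`: `R (u_R x) q = s` for the position `x = (q, s)`.
[cite: Kumar2015, Def. 4.1] -/
private theorem apply_toWord (A : Fin δ → Finset (Fin δ)) (hA : ∀ q, (A q).card = n)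
    (eC eS : Fin (n * δ) ≃ Fin δ × Fin n) (hCS : ∀ x, symbAt A hA (eC x).1 (eC x).2 = (eS x).1)
    {R : Fin n → Fin δ → Fin δ} (hL : IsLatinRect R) (hP : pattern R = A) (x : Fin (n * δ)) :
    R (toWord A hA eC eS hCS hL hP x) (eC x).1 = (eS x).1 := by
  have h := Equiv.apply_symm_apply (colEquiv hA hL hP (eC x).1) ⟨(eS x).1, symb_mem A hA eC eS hCS x⟩
  have h' := congrArg Subtype.val h
  rw [colEquiv_apply_val] at h'
  exact h'

/-- Uniqueness in a column: `R p q = s ⇒ u_R (q, s) = p` (plumbing). [cite: Kumar2015, Def. 4.1] -/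
private theorem toWord_eq_of_apply_eq (A : Fin δ → Finset (Fin δ)) (hA : ∀ q, (A q).card = n)
    (eC eS : Fin (n * δ) ≃ Fin δ × Fin n) (hCS : ∀ x, symbAt A hA (eC x).1 (eC x).2 = (eS x).1)
    {R : Fin n → Fin δ → Fin δ} (hL : IsLatinRect R) (hP : pattern R = A) (x : Fin (n * δ))
    {p : Fin n} (hp : R p (eC x).1 = (eS x).1) : toWord A hA eC eS hCS hL hP x = p :=
  hL.2 (eC x).1 ((apply_toWord A hA eC eS hCS hL hP x).trans hp.symm)

/-- **`u_R` is a proper colouring of the column structure** (a column has distinct symbols).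
[cite: Kumar2015, Def. 4.1] -/
private theorem blockWord_col_toWord_bijective (A : Fin δ → Finset (Fin δ)) (hA : ∀ q, (A q).card = n)
    (eC eS : Fin (n * δ) ≃ Fin δ × Fin n) (hCS : ∀ x, symbAt A hA (eC x).1 (eC x).2 = (eS x).1)
    {R : Fin n → Fin δ → Fin δ} (hL : IsLatinRect R) (hP : pattern R = A) (q : Fin δ) :
    Function.Bijective (blockWord eC (toWord A hA eC eS hCS hL hP) q) := by
  refine (Finite.injective_iff_bijective).1 fun j j' h => ?_
  simp only [blockWord] at h
  -- both positions lie in column `q`; equal rows force equal symbols, hence equal positions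
  have hx := apply_toWord A hA eC eS hCS hL hP (eC.symm (q, j))
  have hy := apply_toWord A hA eC eS hCS hL hP (eC.symm (q, j'))
  simp only [Equiv.apply_symm_apply] at hx hy
  rw [h] at hx
  have hxy : eC.symm (q, j) = eC.symm (q, j') :=
    pos_eq_of_col_eq_of_symb_eq A hA eC eS hCS (by simp) (hx.symm.trans hy)
  simpa using congrArg (fun z => (eC z).2) hxy

/-- **`u_R` is a proper colouring of the symbol structure** (a symbol sits once in every row).
[cite: Kumar2015, Def. 4.1] -/
private theorem blockWord_sym_toWord_bijective (A : Fin δ → Finset (Fin δ)) (hA : ∀ q, (A q).card = n)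
    (eC eS : Fin (n * δ) ≃ Fin δ × Fin n) (hCS : ∀ x, symbAt A hA (eC x).1 (eC x).2 = (eS x).1)
    {R : Fin n → Fin δ → Fin δ} (hL : IsLatinRect R) (hP : pattern R = A) (s : Fin δ) :
    Function.Bijective (blockWord eS (toWord A hA eC eS hCS hL hP) s) := by
  refine (Finite.injective_iff_bijective).1 fun i i' h => ?_
  simp only [blockWord] at h
  have hsx : (eS (eS.symm (s, i))).1 = s := by simp
  have hsy : (eS (eS.symm (s, i'))).1 = s := by simp
  have h1 := apply_toWord A hA eC eS hCS hL hP (eS.symm (s, i))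
  have h2 := apply_toWord A hA eC eS hCS hL hP (eS.symm (s, i'))
  rw [hsx] at h1
  rw [hsy, ← h] at h2
  -- the row `u_R x` carries `s` in the columns of both positions: equal columns (rows injective)
  have hc : (eC (eS.symm (s, i))).1 = (eC (eS.symm (s, i'))).1 := (hL.1 _).1 (h1.trans h2.symm)
  have hxy : eS.symm (s, i) = eS.symm (s, i') :=
    pos_eq_of_col_eq_of_symb_eq A hA eC eS hCS hc (hsx.trans hsy.symm)
  simpa using congrArg (fun z => (eS z).2) hxy

/-- **`R_u` has pattern `𝒜`.** [cite: Kumar2015, Def. 4.1] -/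
private theorem pattern_toRect (A : Fin δ → Finset (Fin δ)) (hA : ∀ q, (A q).card = n)
    (eC : Fin (n * δ) ≃ Fin δ × Fin n) (u : Word n (n * δ))
    (hu : ∀ q, Function.Bijective (blockWord eC u q)) : pattern (toRect A hA eC u hu) = A := by
  classical
  funext q
  unfold pattern toRect
  ext s
  simp only [Finset.mem_image, Finset.mem_univ, true_and]
  constructor
  · rintro ⟨p, rfl⟩
    exact symbAt_mem A hA q _
  · intro hs
    obtain ⟨j, hj⟩ := exists_symbAt_eq A hA hs
    exact ⟨(Equiv.ofBijective _ (hu q)) j, by rw [Equiv.symm_apply_apply, hj]⟩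

/-- **`R_u` is a Latin rectangle** when `u` is proper for both structures: columns are injective
(distinct positions of a column block carry distinct symbols) and rows are injective (two columns of
one row carrying the same symbol are two positions of one symbol block with the same letter).
[cite: Kumar2015, Def. 4.1] -/
private theorem isLatinRect_toRect (A : Fin δ → Finset (Fin δ)) (hA : ∀ q, (A q).card = n)
    (eC eS : Fin (n * δ) ≃ Fin δ × Fin n) (hCS : ∀ x, symbAt A hA (eC x).1 (eC x).2 = (eS x).1)
    (u : Word n (n * δ)) (hu : ∀ q, Function.Bijective (blockWord eC u q))
    (hu' : ∀ s, Function.Bijective (blockWord eS u s)) : IsLatinRect (toRect A hA eC u hu) := by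
  refine ⟨fun p => (Finite.injective_iff_bijective).1 fun q q' h => ?_, fun q p p' h => ?_⟩
  · -- rows: the two positions carry the letter `p` and the same symbol, so they coincide
    simp only [toRect] at h
    have hux := blockWord_toRect_index eC u hu p q
    have huy := blockWord_toRect_index eC u hu p q'
    have hsx := hCS (eC.symm (q, (Equiv.ofBijective _ (hu q)).symm p))
    have hsy := hCS (eC.symm (q', (Equiv.ofBijective _ (hu q')).symm p))
    simp only [Equiv.apply_symm_apply] at hsx hsy
    have hxy := pos_eq_of_block_eq_of_letter_eq eS u hu'
      (hsx.symm.trans (h.trans hsy)) (hux.trans huy.symm)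
    simpa using congrArg (fun z => (eC z).1) hxy
  · -- columns: `symbAt q` and `σ_q⁻¹` are injective
    simp only [toRect] at h
    exact (Equiv.ofBijective _ (hu q)).symm.injective (symbAt_injective A hA q h)

/-- `Ψ ∘ Φ = id`: the colouring of `R_u` is `u`. [cite: Kumar2015, Def. 4.1] -/
private theorem toWord_toRect (A : Fin δ → Finset (Fin δ)) (hA : ∀ q, (A q).card = n)
    (eC eS : Fin (n * δ) ≃ Fin δ × Fin n) (hCS : ∀ x, symbAt A hA (eC x).1 (eC x).2 = (eS x).1)
    (u : Word n (n * δ)) (hu : ∀ q, Function.Bijective (blockWord eC u q))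
    (hu' : ∀ s, Function.Bijective (blockWord eS u s)) :
    toWord A hA eC eS hCS (isLatinRect_toRect A hA eC eS hCS u hu hu') (pattern_toRect A hA eC u hu) =
      u := by
  funext x
  apply toWord_eq_of_apply_eq
  simp only [toRect]
  rw [← hCS x]
  congr 1
  have h : (Equiv.ofBijective _ (hu (eC x).1)) (eC x).2 = u x := by
    rw [Equiv.ofBijective_apply, blockWord_self]
  rw [← h, Equiv.symm_apply_apply]

/-- `Φ ∘ Ψ = id`: the rectangle of `u_R` is `R`. [cite: Kumar2015, Def. 4.1] -/
private theorem toRect_toWord (A : Fin δ → Finset (Fin δ)) (hA : ∀ q, (A q).card = n)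
    (eC eS : Fin (n * δ) ≃ Fin δ × Fin n) (hCS : ∀ x, symbAt A hA (eC x).1 (eC x).2 = (eS x).1)
    {R : Fin n → Fin δ → Fin δ} (hL : IsLatinRect R) (hP : pattern R = A)
    (hu : ∀ q, Function.Bijective (blockWord eC (toWord A hA eC eS hCS hL hP) q)) :
    toRect A hA eC (toWord A hA eC eS hCS hL hP) hu = R := by
  funext p q
  simp only [toRect]
  -- the position `(q, j)`, `j := σ_q⁻¹ p`, has letter `p`, so `R p q` is its symbol `symbAt q j`
  have h1 := blockWord_toRect_index eC (toWord A hA eC eS hCS hL hP) hu p q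
  have h2 := apply_toWord A hA eC eS hCS hL hP
    (eC.symm (q, (Equiv.ofBijective _ (hu q)).symm p))
  rw [h1] at h2
  simp only [Equiv.apply_symm_apply] at h2
  have h3 := hCS (eC.symm (q, (Equiv.ofBijective _ (hu q)).symm p))
  simp only [Equiv.apply_symm_apply] at h3
  rw [h2, ← h3]

/-- **Column signs agree**: Kumar's `ε(column q of R_u)` (read by increasing row) is the sign of the
column word of `u` (read by increasing symbol) — inverse permutations have the same sign.
[cite: Kumar2015, Def. 4.1 (ε_c)] -/
private theorem seqSign_toRect_col (A : Fin δ → Finset (Fin δ)) (hA : ∀ q, (A q).card = n)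
    (eC : Fin (n * δ) ≃ Fin δ × Fin n) (u : Word n (n * δ))
    (hu : ∀ q, Function.Bijective (blockWord eC u q)) (q : Fin δ) :
    seqSign (fun p => toRect A hA eC u hu p q) = seqSign (blockWord eC u q) := by
  have h1 : (fun p => toRect A hA eC u hu p q) =
      symbAt A hA q ∘ ⇑(Equiv.ofBijective _ (hu q)).symm := rfl
  rw [h1, seqSign_strictMono_comp _ (symbAt_strictMono A hA q),
    show (Equiv.ofBijective _ (hu q)).symm = (Equiv.ofBijective _ (hu q))⁻¹ from rfl,
    seqSign_coe_perm, Equiv.Perm.sign_inv, ← seqSign_coe_perm, Equiv.coe_ofBijective]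

/-- `sgn² = 1` for the cast of a unit of `ℤ` (plumbing). [folklore] -/
private theorem cast_units_sq (s : ℤˣ) : (((s : ℤ) : K)) * ((s : ℤ) : K) = 1 := by
  rw [← Int.cast_mul, ← Units.val_mul, Int.units_mul_self, Units.val_one, Int.cast_one]

/-- **The incidence design on the diagonal**: `ζ_C(u) ζ_S(u) ζ_S(u)` is the product of the column
signs of `u` if `u` is proper for both structures, and `0` otherwise (the symbol signs square away).
[cite: BurgisserIkenmeyer2017, Thm. 5.9 (proof of (2))] -/
private theorem blockSignTriple_incidence_diag (eC eS : Fin (n * δ) ≃ Fin δ × Fin n)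
    (u : Word n (n * δ)) :
    blockSignTriple K eC eS eS ((u, u), u) =
      if (∀ q, Function.Bijective (blockWord eC u q)) ∧ (∀ s, Function.Bijective (blockWord eS u s))
      then ∏ q, (((seqSign (blockWord eC u q) : ℤˣ) : ℤ) : K) else 0 := by
  have hC : wordBlockSign K eC u = if ∀ q, Function.Bijective (blockWord eC u q) then
      ∏ q, (((seqSign (blockWord eC u q) : ℤˣ) : ℤ) : K) else 0 := rfl
  have hS : wordBlockSign K eS u = if ∀ s, Function.Bijective (blockWord eS u s) then
      ∏ s, (((seqSign (blockWord eS u s) : ℤˣ) : ℤ) : K) else 0 := rfl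
  rw [blockSignTriple, hC, hS]
  by_cases hc : ∀ q, Function.Bijective (blockWord eC u q)
  · by_cases hs : ∀ s, Function.Bijective (blockWord eS u s)
    · have h1 : ∏ s, (((seqSign (blockWord eS u s) : ℤˣ) : ℤ) : K) *
          (((seqSign (blockWord eS u s) : ℤˣ) : ℤ) : K) = 1 :=
        Finset.prod_eq_one fun s _ => cast_units_sq K _
      rw [if_pos hc, if_pos hs, if_pos ⟨hc, hs⟩, mul_assoc, ← Finset.prod_mul_distrib, h1, mul_one]
    · have hcs : ¬ ((∀ q, Function.Bijective (blockWord eC u q)) ∧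
          (∀ s, Function.Bijective (blockWord eS u s))) := fun h => hs h.2
      rw [if_neg hs, if_neg hcs, mul_zero]
  · have hcs : ¬ ((∀ q, Function.Bijective (blockWord eC u q)) ∧
        (∀ s, Function.Bijective (blockWord eS u s))) := fun h => hc h.1
    rw [if_neg hc, if_neg hcs, zero_mul, zero_mul]

/-- **The diagonal trace of the incidence design of a pattern is Kumar's signed count
`♯L⁺_𝒜 − ♯L⁻_𝒜`** — the evaluation at the unit tensor of BILPS's rectangular-design highest weight
vector restricted to the pattern `𝒜` ("Nontriviality of the equations": `∑_L det(L)` over the Latin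
rectangles; Kumar Lemma 4.2 groups it by patterns). Here `eC`, `eS` are any column / symbol
structures on `nδ` positions whose incidences are those of `𝒜` (`hCS`: the `j`-th position of column
block `q` carries the `j`-th symbol of `𝒜^q`, and that symbol is its `eS`-block).
[cite: BlaserIkenmeyerLysikovPandeySchreyer2019, Thm. 27 (proof: nontriviality of the equations)]
[cite: Kumar2015, Def. 4.1 and Lemma 4.2] -/
theorem sum_blockSignTriple_incidence_eq_signedCount (A : Fin δ → Finset (Fin δ))
    (hA : ∀ q, (A q).card = n) (eC eS : Fin (n * δ) ≃ Fin δ × Fin n)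
    (hCS : ∀ x, (A (eC x).1).orderEmbOfFin (hA (eC x).1) (eC x).2 = (eS x).1) :
    ∑ u : Word n (n * δ), blockSignTriple K eC eS eS ((u, u), u) = ((signedCount n δ A : ℤ) : K) := by
  classical
  change ∀ x, symbAt A hA (eC x).1 (eC x).2 = (eS x).1 at hCS
  simp_rw [blockSignTriple_incidence_diag K eC eS]
  rw [← Finset.sum_filter, signedCount, Int.cast_sum]
  refine Finset.sum_bij'
    (fun u hu => toRect A hA eC u (Finset.mem_filter.mp hu).2.1)
    (fun R hR => toWord A hA eC eS hCS (Finset.mem_filter.mp hR).2.1 (Finset.mem_filter.mp hR).2.2)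
    ?_ ?_ ?_ ?_ ?_
  · intro u hu
    obtain ⟨-, hc, hs⟩ := Finset.mem_filter.mp hu
    exact Finset.mem_filter.mpr ⟨Finset.mem_univ _, isLatinRect_toRect A hA eC eS hCS u hc hs,
      pattern_toRect A hA eC u hc⟩
  · intro R hR
    obtain ⟨-, hL, hP⟩ := Finset.mem_filter.mp hR
    exact Finset.mem_filter.mpr ⟨Finset.mem_univ _,
      blockWord_col_toWord_bijective A hA eC eS hCS hL hP,
      blockWord_sym_toWord_bijective A hA eC eS hCS hL hP⟩
  · intro u hu
    obtain ⟨-, hc, hs⟩ := Finset.mem_filter.mp hu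
    exact toWord_toRect A hA eC eS hCS u hc hs
  · intro R hR
    obtain ⟨-, hL, hP⟩ := Finset.mem_filter.mp hR
    exact toRect_toWord A hA eC eS hCS hL hP _
  · intro u hu
    obtain ⟨-, hc, hs⟩ := Finset.mem_filter.mp hu
    rw [rectColSign, Units.coe_prod, Int.cast_prod]
    exact Finset.prod_congr rfl fun q _ => by rw [seqSign_toRect_col A hA eC u hc q]

end IncidenceDesign

/-! ### §2 Existence of the incidence design; Latin rectangles force biregular patterns -/

section Existence

variable {n δ : ℕ}

/-- In a Latin `(n, δ)`-rectangle every symbol meets exactly `n` columns (once in every row, in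
pairwise distinct columns). [cite: Kumar2015, Def. 4.1] -/
theorem card_filter_mem_pattern_of_isLatinRect {R : Fin n → Fin δ → Fin δ} (hR : IsLatinRect R)
    (s : Fin δ) : (Finset.univ.filter fun q => s ∈ pattern R q).card = n := by
  classical
  -- the column of `s` in row `p`
  have hc : ∀ p, R p ((Equiv.ofBijective _ (hR.1 p)).symm s) = s := fun p => by
    have := Equiv.apply_symm_apply (Equiv.ofBijective _ (hR.1 p)) s
    rwa [Equiv.ofBijective_apply] at this
  have hcinj : Function.Injective fun p => (Equiv.ofBijective _ (hR.1 p)).symm s := fun p p' h => by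
    apply hR.2 ((Equiv.ofBijective _ (hR.1 p)).symm s)
    have h' := hc p'
    simp only at h
    rw [← h] at h'
    exact (hc p).trans h'.symm
  have heq : (Finset.univ.filter fun q => s ∈ pattern R q) =
      Finset.univ.image fun p => (Equiv.ofBijective _ (hR.1 p)).symm s := by
    ext q
    simp only [Finset.mem_filter, Finset.mem_univ, true_and, Finset.mem_image, pattern]
    constructor
    · rintro ⟨p, hp⟩
      refine ⟨p, (hR.1 p).1 ?_⟩
      rw [hc p, hp]
    · rintro ⟨p, rfl⟩
      exact ⟨p, hc p⟩
  rw [heq, Finset.card_image_of_injective _ hcinj, Finset.card_univ, Fintype.card_fin]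

/-- **The incidence design of a biregular pattern exists**: if every column set `𝒜^q` has `n`
symbols and every symbol lies in `n` column sets, there are a column structure `e_C` (column blocks
read by increasing symbol) and a symbol structure `e_S` on `nδ` positions with the same incidences.
[cite: BlaserIkenmeyerLysikovPandeySchreyer2019, §7.3 (Thm. 27, construction of highest weight vectors)] -/
theorem exists_incidenceDesign (A : Fin δ → Finset (Fin δ)) (hA : ∀ q, (A q).card = n)
    (hB : ∀ s, (Finset.univ.filter fun q => s ∈ A q).card = n) :
    ∃ eC eS : Fin (n * δ) ≃ Fin δ × Fin n,
      ∀ x, (A (eC x).1).orderEmbOfFin (hA (eC x).1) (eC x).2 = (eS x).1 := by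
  classical
  -- the incidences `(q, s)`, `s ∈ 𝒜^q`, of the pattern
  have hcardP : Fintype.card (Fin δ × Fin n) = Fintype.card (Σ q : Fin δ, A q) := by
    rw [Fintype.card_prod, Fintype.card_fin, Fintype.card_fin, Fintype.card_sigma]
    simp_rw [Fintype.card_coe, hA]
    rw [Finset.sum_const, Finset.card_univ, Fintype.card_fin, smul_eq_mul]
  -- column blocks, read by increasing symbol
  let fC : Fin δ × Fin n → (Σ q : Fin δ, A q) := fun y =>
    ⟨y.1, ⟨(A y.1).orderEmbOfFin (hA y.1) y.2, Finset.orderEmbOfFin_mem _ _ _⟩⟩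
  have hfC : Function.Bijective fC := by
    rw [Fintype.bijective_iff_injective_and_card, hcardP]
    refine ⟨fun y y' h => ?_, rfl⟩
    obtain ⟨q, j⟩ := y
    obtain ⟨q', j'⟩ := y'
    simp only [fC, Sigma.mk.injEq] at h
    obtain ⟨rfl, h2⟩ := h
    simp only [heq_eq_eq, Subtype.mk.injEq] at h2
    exact Prod.ext rfl (((A q).orderEmbOfFin (hA q)).injective h2)
  -- symbol blocks
  let fS : Fin δ × Fin n → (Σ q : Fin δ, A q) := fun y =>
    ⟨(Finset.univ.filter fun q => y.1 ∈ A q).orderEmbOfFin (hB y.1) y.2,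
      ⟨y.1, (Finset.mem_filter.mp (Finset.orderEmbOfFin_mem _ (hB y.1) y.2)).2⟩⟩
  have hfS : Function.Bijective fS := by
    rw [Fintype.bijective_iff_injective_and_card, hcardP]
    refine ⟨fun y y' h => ?_, rfl⟩
    obtain ⟨s, i⟩ := y
    obtain ⟨s', i'⟩ := y'
    have h1 : s = s' := congrArg (fun z : (Σ q : Fin δ, A q) => (z.2 : Fin δ)) h
    subst h1
    have h2 := congrArg (fun z : (Σ q : Fin δ, A q) => z.1) h
    simp only [fS] at h2
    exact Prod.ext rfl (((Finset.univ.filter fun q => s ∈ A q).orderEmbOfFin (hB s)).injective h2)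
  let eC' : Fin δ × Fin n ≃ (Σ q : Fin δ, A q) := Equiv.ofBijective fC hfC
  let eS' : Fin δ × Fin n ≃ (Σ q : Fin δ, A q) := Equiv.ofBijective fS hfS
  let e0 : Fin (n * δ) ≃ Fin δ × Fin n := (finCongr (Nat.mul_comm n δ)).trans finProdFinEquiv.symm
  refine ⟨e0, e0.trans (eC'.trans eS'.symm), fun x => ?_⟩
  -- the symbol of the incidence `eC' (e0 x)` is read off by `eS'.symm`
  have key : ∀ z : (Σ q : Fin δ, A q), (eS'.symm z).1 = (z.2 : Fin δ) := by
    intro z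
    obtain ⟨y, rfl⟩ := eS'.surjective z
    rw [Equiv.symm_apply_apply]
    rfl
  simp only [Equiv.trans_apply]
  rw [key]
  rfl

end Existence

end LRCDesign

/-! ### §3 The bridge: `LRC(n, δ) ⇒ k_n(δ) > 0` -/

section Bridge

variable (K : Type*) [Field K] [CharZero K] {n δ : ℕ}

/-- **A pattern with `♯L⁺_𝒜 ≠ ♯L⁻_𝒜` certifies `k_n(δ) > 0`** (Kumar's signed count of the Latin
`(n, δ)`-rectangles with pattern `𝒜`; the incidence design of `𝒜` is a block-sign design certificate).
[cite: Kumar2015, Def. 4.1 and Lemma 4.2] [cite: BlaserIkenmeyerLysikovPandeySchreyer2019, Thm. 27]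
[cite: AmanovYeliussizov2022, Rem. 8.9] -/
theorem kronRect_pos_of_signedCount_ne_zero (A : Fin δ → Finset (Fin δ)) (h : signedCount n δ A ≠ 0) :
    0 < kronRect K n δ := by
  classical
  -- some Latin rectangle has pattern `A`, so `A` is biregular
  obtain ⟨R, hL, hP⟩ : ∃ R : Fin n → Fin δ → Fin δ, IsLatinRect R ∧ pattern R = A := by
    by_contra hne
    push Not at hne
    apply h
    unfold signedCount
    exact Finset.sum_eq_zero fun R hR => by
      obtain ⟨-, hL, hP⟩ := Finset.mem_filter.mp hR
      exact absurd hP (hne R hL)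
  have hA : ∀ q, (A q).card = n := fun q => by rw [← hP]; exact card_pattern_of_isLatinRect hL q
  have hB : ∀ s, (Finset.univ.filter fun q => s ∈ A q).card = n := fun s => by
    rw [← hP]; exact LRCDesign.card_filter_mem_pattern_of_isLatinRect hL s
  obtain ⟨eC, eS, hCS⟩ := LRCDesign.exists_incidenceDesign A hA hB
  refine kronRect_pos_of_sum_blockSignTriple_diag_ne_zero K eC eS eS ?_
  rw [LRCDesign.sum_blockSignTriple_incidence_eq_signedCount K A hA eC eS hCS]
  exact Int.cast_ne_zero.2 h

/-- **`LRC(n, δ) ⇒ k_n(δ) > 0`** — the rectangular Kronecker coefficient `g(n × δ, n × δ, n × δ)` is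
positive whenever the Latin-rectangle condition of BILPS §7.3 holds: the Kronecker content of the
isotypic type `((k × m), (m × k), (m × k))` of BILPS Thm. 27 (`k = n`, `m = δ`;
`g((m^k),(k^m),(k^m)) = g((m^k),(m^k),(m^k))` by the transposition property), equivalently
Amanov–Yeliussizov's Cor. 8.7 in the pattern form of their Rem. 8.9. Over any field of
characteristic `0`. [cite: BlaserIkenmeyerLysikovPandeySchreyer2019, Thm. 27 (p0026:L36)]
[cite: AmanovYeliussizov2022, Cor. 8.7 (p0019:L105) and Rem. 8.9 (p0020:L1)] -/
theorem kronRect_pos_of_latinRectangleCondition (h : latinRectangleCondition n δ) :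
    0 < kronRect K n δ := by
  obtain ⟨A, hA⟩ := latinRectangleCondition_iff_exists_signedCount_ne_zero.mp h
  exact kronRect_pos_of_signedCount_ne_zero K A hA

/-- **AY 2022 Cor. 8.7 for `d = 3` (PROVED): "Assume `AT(k) ≠ 0` for even `k`. Then `g_d(n, k) > 0`
for all `n ≤ k`"** — here with `AT(k)` the tree's `AlonTarsiConjecture k` (through Kumar:
`AT(δ) ⇒ LRC(n, δ)` for `n ≤ δ`, `latinRectangleCondition_of_alonTarsi`).
[cite: AmanovYeliussizov2022, Cor. 8.7 (p0019:L105–110)] -/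
theorem kronRect_pos_of_alonTarsi (hAT : AlonTarsiConjecture δ) (hn : n ≤ δ) : 0 < kronRect K n δ :=
  kronRect_pos_of_latinRectangleCondition K (latinRectangleCondition_of_alonTarsi hn hAT)

/-- **`k_n(δ) > 0` for every `n ≤ 12` and every even `δ ≥ n`** (unconditional; `LRC(α, β)` for
`α ≤ 12`, `β ≥ α` even, `latinRectangleCondition_of_le_twelve`).
[cite: BlaserIkenmeyerLysikovPandeySchreyer2019, §7.3 (remarks after Conj. 26)] -/
theorem kronRect_pos_of_le_twelve_of_even (h12 : n ≤ 12) (hn : n ≤ δ) (hδ : Even δ) :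
    0 < kronRect K n δ :=
  kronRect_pos_of_latinRectangleCondition K (latinRectangleCondition_of_le_twelve h12 hn hδ)

/-- **`k_n(δ) > 0` for every `n ≤ δ`, `δ` even, `2 ≤ δ ≤ 24`** (unconditional: Alon–Tarsi for even
orders `≤ 24` is a theorem of the tree, Drisko `p + 1` / Glynn `p − 1`).
[cite: AmanovYeliussizov2022, Cor. 8.7 and Rem. 7.3] -/
theorem kronRect_pos_of_le_of_even_le_24 (hn : n ≤ δ) (hδ : Even δ) (h2 : 2 ≤ δ) (h24 : δ ≤ 24) :
    0 < kronRect K n δ :=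
  kronRect_pos_of_latinRectangleCondition K (latinRectangleCondition_of_even_le_24 hn hδ h2 h24)

/-- **`k_n(p + 1) > 0` for every `n ≤ p + 1`**, `p` an odd prime (Drisko's Alon–Tarsi theorem).
[cite: AmanovYeliussizov2022, Cor. 8.7 and Rem. 7.3] -/
theorem kronRect_pos_of_le_prime_add_one {p : ℕ} (hp : p.Prime) (hodd : Odd p) (hn : n ≤ p + 1) :
    0 < kronRect K n (p + 1) :=
  kronRect_pos_of_latinRectangleCondition K (latinRectangleCondition_prime_add_one hp hodd hn)

/-- **`k_n(p − 1) > 0` for every `n ≤ p − 1`**, `p` an odd prime (Glynn's Alon–Tarsi theorem).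
[cite: AmanovYeliussizov2022, Cor. 8.7 and Rem. 7.3] -/
theorem kronRect_pos_of_le_prime_sub_one {p : ℕ} (hp : p.Prime) (hodd : Odd p) (hn : n ≤ p - 1) :
    0 < kronRect K n (p - 1) :=
  kronRect_pos_of_latinRectangleCondition K (latinRectangleCondition_prime_sub_one hp hodd hn)

/-- **`k_n(δ) > 0` for EVERY `n` and every even `δ ≥ 2n²`**: the generic degree monoid `E'(n)`
contains all even `δ ≥ 2n²` (unconditional; `LRC(α, β)` for every even `β ≥ 2α²`,
`latinRectangleCondition_of_two_mul_sq_le`).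
[cite: BlaserIkenmeyerLysikovPandeySchreyer2019, §7.3 (Conj. 26)] [cite: BurgisserIkenmeyer2017, §5 eq. (5.2)] -/
theorem kronRect_pos_of_two_mul_sq_le (hδ : 2 * n ^ 2 ≤ δ) (he : Even δ) : 0 < kronRect K n δ :=
  kronRect_pos_of_latinRectangleCondition K (latinRectangleCondition_of_two_mul_sq_le hδ he)

end Bridge

/-! ### §4 Consequences for the degree monoids `E(m)` and the minimal degrees `e(m)` of generic tensors -/

section Degrees

variable {n δ j : ℕ}

/-- **`nδ ∈ E(n)` whenever `LRC(n, δ)`** (`n ≥ 1`): generic tensors of format `n × n × n` have a nonzero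
`SL_n³`-invariant of degree `nδ`. [cite: BurgisserIkenmeyer2017, §5 eq. (5.2)]
[cite: AmanovYeliussizov2022, Cor. 8.7] -/
theorem mul_mem_genericTensorDegreeMonoid_of_latinRectangleCondition (h : latinRectangleCondition n δ) :
    n * δ ∈ genericTensorDegreeMonoid (Fin n) ℂ := by
  rw [genericTensorDegreeMonoid_eq_kronRect n]
  exact ⟨δ, rfl, kronRect_pos_of_latinRectangleCondition ℂ h⟩

/-- **Every even multiple `nδ`, `δ ≥ 2n²`, lies in `E(n)`** (unconditional, every `n`).
[cite: BurgisserIkenmeyer2017, §5 eq. (5.2) and Problem 5.19] -/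
theorem mul_mem_genericTensorDegreeMonoid_of_two_mul_sq_le (hδ : 2 * n ^ 2 ≤ δ) (he : Even δ) :
    n * δ ∈ genericTensorDegreeMonoid (Fin n) ℂ :=
  mul_mem_genericTensorDegreeMonoid_of_latinRectangleCondition (latinRectangleCondition_of_two_mul_sq_le hδ he)

/-- **The complement form: `LRC(j, δ) ⇒ k_{δ² − j}(δ) > 0`** (`k_j(δ) = k_{δ²-j}(δ)`, AY Thm. 5.1 (ii) /
the tree's `kronRect_sq_sub_pos`). [cite: AmanovYeliussizov2022, Rem. 8.8] -/
theorem kronRect_sq_sub_pos_of_latinRectangleCondition (hj : j ≤ δ) (h : latinRectangleCondition j δ) :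
    0 < kronRect ℂ (δ * δ - j) δ :=
  kronRect_sq_sub_pos (hj.trans (Nat.le_mul_self δ)) (kronRect_pos_of_latinRectangleCondition ℂ h)

/-- **AY 2022 Rem. 8.8 for `d = 3` (PROVED): `AT(δ) ≠ 0` gives `e(δ² − j) = (δ² − j)·δ` for all
`j ≤ δ`** ("we get `δ_d(k^{d-1} - n) = (k^{d-1} - n) k` for all `n ≤ k`"; `δ ≥ 2`; the near-square
principle `genericTensorMinimalDegree_sq_sub_eq` of the tree fed with `k_j(δ) > 0`).
[cite: AmanovYeliussizov2022, Rem. 8.8 (p0019:L112)] [cite: BurgisserIkenmeyer2017, Problem 5.19] -/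
theorem genericTensorMinimalDegree_sq_sub_eq_of_alonTarsi (hAT : AlonTarsiConjecture δ) (h2 : 2 ≤ δ)
    (hj : j ≤ δ) : genericTensorMinimalDegree (Fin (δ * δ - j)) ℂ = (δ * δ - j) * δ :=
  genericTensorMinimalDegree_sq_sub_eq (by omega) (kronRect_pos_of_alonTarsi ℂ hAT hj)

/-- **`e(δ² − j) = (δ² − j)·δ` for all `j ≤ δ`, unconditionally for `δ` even, `2 ≤ δ ≤ 24`** (e.g.
`e(90), …, e(100) = 900, …, 1000` at `δ = 10`; `e(552), …, e(576)` at `δ = 24`).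
[cite: AmanovYeliussizov2022, Rem. 8.8] [cite: BurgisserIkenmeyer2017, Problem 5.19] -/
theorem genericTensorMinimalDegree_sq_sub_eq_of_even_le_24 (hδ : Even δ) (h2 : 2 ≤ δ) (h24 : δ ≤ 24)
    (hj : j ≤ δ) : genericTensorMinimalDegree (Fin (δ * δ - j)) ℂ = (δ * δ - j) * δ :=
  genericTensorMinimalDegree_sq_sub_eq (by omega)
    (kronRect_pos_of_le_of_even_le_24 ℂ hj hδ h2 h24)

/-- **`e((p+1)² − j) = ((p+1)² − j)·(p+1)` for all `j ≤ p + 1`**, `p` an odd prime (Drisko).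
[cite: AmanovYeliussizov2022, Rem. 8.8] [cite: BurgisserIkenmeyer2017, Problem 5.19] -/
theorem genericTensorMinimalDegree_sq_sub_eq_prime_add_one {p : ℕ} (hp : p.Prime) (hodd : Odd p)
    (hj : j ≤ p + 1) :
    genericTensorMinimalDegree (Fin ((p + 1) * (p + 1) - j)) ℂ = ((p + 1) * (p + 1) - j) * (p + 1) := by
  have h2 := hp.two_le
  exact genericTensorMinimalDegree_sq_sub_eq (by omega) (kronRect_pos_of_le_prime_add_one ℂ hp hodd hj)

/-- **`e((p−1)² − j) = ((p−1)² − j)·(p−1)` for all `j ≤ p − 1`**, `p` an odd prime (Glynn).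
[cite: AmanovYeliussizov2022, Rem. 8.8] [cite: BurgisserIkenmeyer2017, Problem 5.19] -/
theorem genericTensorMinimalDegree_sq_sub_eq_prime_sub_one {p : ℕ} (hp : p.Prime) (hodd : Odd p)
    (hj : j ≤ p - 1) :
    genericTensorMinimalDegree (Fin ((p - 1) * (p - 1) - j)) ℂ = ((p - 1) * (p - 1) - j) * (p - 1) := by
  have h3 : 3 ≤ p := by
    obtain ⟨k, rfl⟩ := hodd
    have := hp.two_le
    omega
  exact genericTensorMinimalDegree_sq_sub_eq (by omega) (kronRect_pos_of_le_prime_sub_one ℂ hp hodd hj)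

/-- **`k_n(δ) > 0` for `12 < n ≤ δ ≤ 24`, `δ` even — new rows of BI's table beyond `m ≤ 12`**, e.g.
`k_13(14), k_17(18), k_23(24) > 0`, i.e. `182 ∈ E(13)`, `306 ∈ E(17)`, `552 ∈ E(23)`.
[cite: BurgisserIkenmeyer2017, Ex. 5.6 and Problem 5.19] -/
theorem mem_genericTensorDegreeMonoid_examples :
    182 ∈ genericTensorDegreeMonoid (Fin 13) ℂ ∧ 306 ∈ genericTensorDegreeMonoid (Fin 17) ℂ ∧
      552 ∈ genericTensorDegreeMonoid (Fin 23) ℂ := by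
  refine ⟨?_, ?_, ?_⟩
  · rw [genericTensorDegreeMonoid_eq_kronRect 13]
    exact ⟨14, rfl, kronRect_pos_of_le_of_even_le_24 ℂ (by norm_num) (by decide) (by norm_num) (by norm_num)⟩
  · rw [genericTensorDegreeMonoid_eq_kronRect 17]
    exact ⟨18, rfl, kronRect_pos_of_le_of_even_le_24 ℂ (by norm_num) (by decide) (by norm_num) (by norm_num)⟩
  · rw [genericTensorDegreeMonoid_eq_kronRect 23]
    exact ⟨24, rfl, kronRect_pos_of_le_of_even_le_24 ℂ (by norm_num) (by decide) (by norm_num) (by norm_num)⟩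

end Degrees

end Literature.Computability.AlgebraicComplexity

end
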